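import Summits.CriticalPhenomena.PercolationContinuityZ3.Theorems.Transplant.CayleySkeletonConn
import Summits.CriticalPhenomena.PercolationContinuityZ3.Theorems.Transplant.SkeletonKernelGenerators
import Summits.CriticalPhenomena.PercolationContinuityZ3.Theorems.Transplant.CayleyNilTwoLetters
import HarnessLib

/-!
# Commutator walks in a Cayley graph and the COMPANION ALPHABET of a unit-range chart (toolbox for the class-2 connected-cylinder theorem)

builds on p205010 (kernel theorem, internal audit signed; external expert review pending) — nothing in this file uses p205010.  Lane `prim-bschramm`,
seat `prim-bschramm-p4` gen 13 (PART C3 of `P4-GENERAL.md` §35.7).  Helper file (`--supports stmt-CriticalPhenomena-4575 --as helper`).  Pure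
group theory + walks; no percolation.

For a `CylBase` (additive `φ : Γ → ℤ²`, unit range on `S`, unit steps `s₀, s₁ ∈ S`) on an ARBITRARY group:
* §1 WALKS WITH CONTROLLED HEIGHTS in `Cay(Γ; S)`: `walk_inv` (`1 → g⁻¹`, heights shifted by `−φ g`), **`walk_commutator`** (`1 → ⁅g, h⁆ = g h g⁻¹ h⁻¹`
  along `w_g · g w_h · gh w_{g⁻¹} · ghg⁻¹ w_{h⁻¹}`, heights in `P_g ∪ (φ g + P_h) ∪ (φ h + P_g) ∪ P_h`), `walk_letter`, `walk_zpow_unit`, **`walk_proj`**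
  (`1 → s → s s₁^{−φ₁ s} → π(s)`, heights `0, φ s, (φ₀ s, 0)` — in the unit box, `proj_heights_mem_box`), where `π(s) = s s₁^{−φ₁ s} s₀^{−φ₀ s} ∈ ker φ`;
* §2 the **COMPANION ALPHABET** (class-2 identities `⁅a⁻¹, b⁆ = ⁅a, b⁆⁻¹` are gen 10's `NilTwoSigns.SignData.comm_inv_left`)
  `compAlph = {s₀^{±1}, s₁^{±1}} ∪ {π(s)^{±1} : s ∈ S}` — symmetric (`compAlph_symm`), LETTERS-TYPE (`compAlph_letters`: every letter in `ker φ` or a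
  step letter) and generating the same group (`closure_compAlph`: `s = π(s) s₀^{φ₀ s} s₁^{φ₁ s}`), so that the kernel criterion
  `KerGen.mem_closure_of_eq_zero` applies to ANY unit-range alphabet through it.
Sequel: `CayleyClassTwoUnitRange` (`boxWalks_of_classTwo`: in class ≤ 2 the unit cylinder is connected for EVERY unit-range alphabet).
[cite: BenjaminiSchramm1996, §2 (Cayley graphs)] [cite: KozmaNitzan2024, §4 p. 16 (Lemma 8)]
-/

noncomputable section

namespace Summit.CriticalPhenomena.PercolationContinuityZ3.Theorems.Transplant

open SimpleGraph Walk Subgroup Literature.Probability.LatticeModels Literature.Probability.Percolation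
open scoped Classical commutatorElement

namespace CayCyl

namespace CylBase

variable {Γ : Type} [Group Γ] {S : Finset Γ} (B : CylBase Γ S)

/-! ## §1 Walks: inverses, commutators, projections -/

/-- **Inverse walk**: from a walk `1 → g` a walk `1 → g⁻¹` whose heights are the old heights shifted by `−φ g`. [folklore] -/
theorem walk_inv {g : Γ} (wg : (mulCayley (S : Set Γ)).Walk (1 : Γ) g) :
    ∃ w : (mulCayley (S : Set Γ)).Walk (1 : Γ) g⁻¹, ∀ z ∈ w.support, ∃ z' ∈ wg.support, B.φ z + B.φ g = B.φ z' := by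
  refine ⟨(lmul S g⁻¹ wg.reverse).copy (inv_mul_cancel g) (mul_one g⁻¹), fun z hz => ?_⟩
  rw [support_copy] at hz
  obtain ⟨z', hz', rfl⟩ := mem_support_lmul.1 hz
  exact ⟨z', (mem_support_reverse_iff wg z').1 hz', by rw [B.map_mul, B.φ_inv]; abel⟩

/-- **Commutator walk**: walks `1 → g`, `1 → h` give a walk `1 → ⁅g, h⁆ = g h g⁻¹ h⁻¹` whose heights lie in
`P_g ∪ (φ g + P_h) ∪ (φ h + P_g) ∪ P_h`. [folklore] -/
theorem walk_commutator {g h : Γ} (wg : (mulCayley (S : Set Γ)).Walk (1 : Γ) g) (wh : (mulCayley (S : Set Γ)).Walk (1 : Γ) h) :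
    ∃ w : (mulCayley (S : Set Γ)).Walk (1 : Γ) ⁅g, h⁆, ∀ z ∈ w.support,
      (∃ z' ∈ wg.support, B.φ z = B.φ z' ∨ B.φ z = B.φ h + B.φ z') ∨
      (∃ z' ∈ wh.support, B.φ z = B.φ g + B.φ z' ∨ B.φ z = B.φ z') := by
  obtain ⟨wgi, hwgi⟩ := B.walk_inv wg
  obtain ⟨whi, hwhi⟩ := B.walk_inv wh
  refine ⟨wg.append ((((lmul S g wh).copy (mul_one g) rfl).append
    (((lmul S (g * h) wgi).copy (mul_one _) rfl).append ((lmul S (g * h * g⁻¹) whi).copy (mul_one _) (commutatorElement_def g h).symm)))),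
    fun z hz => ?_⟩
  rw [Walk.mem_support_append_iff, Walk.mem_support_append_iff, Walk.mem_support_append_iff, support_copy, support_copy, support_copy] at hz
  rcases hz with hz | hz | hz | hz
  · exact Or.inl ⟨z, hz, Or.inl rfl⟩
  · obtain ⟨z', hz', rfl⟩ := mem_support_lmul.1 hz
    exact Or.inr ⟨z', hz', Or.inl (by rw [B.map_mul])⟩
  · obtain ⟨z'', hz'', rfl⟩ := mem_support_lmul.1 hz
    obtain ⟨z', hz', e⟩ := hwgi z'' hz''
    refine Or.inl ⟨z', hz', Or.inr ?_⟩
    rw [B.map_mul, B.map_mul, ← e]; abel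
  · obtain ⟨z'', hz'', rfl⟩ := mem_support_lmul.1 hz
    obtain ⟨z', hz', e⟩ := hwhi z'' hz''
    refine Or.inr ⟨z', hz', Or.inr ?_⟩
    rw [B.map_mul, B.map_mul, B.map_mul, B.φ_inv, ← e]; abel

/-- **Letter walk**: one edge `1 → t` for `t ∈ S ∪ S⁻¹`, `t ≠ 1`. [folklore] -/
theorem walk_letter {t : Γ} (ht : t ∈ S ∨ t⁻¹ ∈ S) (ht1 : t ≠ 1) :
    ∃ w : (mulCayley (S : Set Γ)).Walk (1 : Γ) t, ∀ z ∈ w.support, B.φ z = 0 ∨ B.φ z = B.φ t := by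
  refine ⟨(Walk.cons (adj_mul_of_mem S ht ht1 1) Walk.nil).copy rfl (one_mul t), fun z hz => ?_⟩
  rw [support_copy, support_cons, support_nil, List.mem_cons, List.mem_singleton] at hz
  rcases hz with rfl | rfl
  · exact Or.inl B.φ_one
  · exact Or.inr (by rw [one_mul])

/-- A step by `t^e`, `|e| ≤ 1`, `t ∈ S`, in a general group: a walk `g → g t^e` with vertices among `g`, `g t^e`. [folklore] -/
theorem walk_zpow_unit {t : Γ} (ht : t ∈ S) (ht1 : t ≠ 1) (g : Γ) (e : ℤ) (he : -1 ≤ e ∧ e ≤ 1) :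
    ∃ w : (mulCayley (S : Set Γ)).Walk g (g * t ^ e), ∀ z ∈ w.support, z ∈ ({g, g * t ^ e} : Set Γ) := by
  rcases (show e = 0 ∨ e = 1 ∨ e = -1 by omega) with rfl | rfl | rfl
  · refine ⟨(Walk.nil : (mulCayley (S : Set Γ)).Walk g g).copy rfl (by rw [zpow_zero, mul_one]), fun z hz => ?_⟩
    rw [support_copy, support_nil, List.mem_singleton] at hz; exact Or.inl hz
  · refine ⟨(Walk.cons (adj_mul_of_mem S (Or.inl ht) ht1 g) Walk.nil).copy rfl (by rw [zpow_one]), fun z hz => ?_⟩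
    rw [support_copy, support_cons, support_nil, List.mem_cons, List.mem_singleton] at hz
    rcases hz with rfl | rfl
    · exact Or.inl rfl
    · exact Or.inr (by rw [zpow_one]; rfl)
  · refine ⟨(Walk.cons (adj_mul_of_mem S (t := t⁻¹) (Or.inr (by rw [inv_inv]; exact ht)) (inv_ne_one.2 ht1) g) Walk.nil).copy rfl
      (by rw [zpow_neg, zpow_one]), fun z hz => ?_⟩
    rw [support_copy, support_cons, support_nil, List.mem_cons, List.mem_singleton] at hz
    rcases hz with rfl | rfl
    · exact Or.inl rfl
    · exact Or.inr (by rw [zpow_neg, zpow_one]; rfl)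

/-- **The projection walk**: `1 → s → s s₁^{−φ₁ s} → π(s)` for a letter `s`, with heights `0`, `φ s`, `(φ₀ s, 0)`. [folklore] -/
theorem walk_proj {s : Γ} (hs : s ∈ S) : ∃ w : (mulCayley (S : Set Γ)).Walk (1 : Γ) (B.proj s),
    ∀ z ∈ w.support, B.φ z = 0 ∨ B.φ z = B.φ s ∨ B.φ z = Pi.single 0 (B.φ s 0) := by
  have h1 : B.φ 1 = 0 := B.φ_one
  have hsb : ∀ i, -1 ≤ B.φ s i ∧ B.φ s i ≤ 1 := fun i => by have := B.lip s hs i; rw [abs_le] at this; exact this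
  by_cases hs1 : s = 1
  · subst hs1
    refine ⟨(Walk.nil : (mulCayley (S : Set Γ)).Walk (1 : Γ) 1).copy rfl (B.proj_of_ker h1).symm, fun z hz => ?_⟩
    rw [support_copy, support_nil, List.mem_singleton] at hz
    exact Or.inl (by rw [hz, h1])
  obtain ⟨w₂, hw₂⟩ := walk_zpow_unit B.s₁_mem B.s₁_ne_one s (-(B.φ s 1)) (by have := hsb 1; omega)
  obtain ⟨w₃, hw₃⟩ := walk_zpow_unit B.s₀_mem B.s₀_ne_one (s * B.s₁ ^ (-(B.φ s 1))) (-(B.φ s 0)) (by have := hsb 0; omega)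
  have e₂ : B.φ (s * B.s₁ ^ (-(B.φ s 1))) = Pi.single 0 (B.φ s 0) := by
    rw [B.map_mul, B.φ_zpow, B.φ_s₁]
    ext i; fin_cases i <;> simp
  have e₃ : B.φ (s * B.s₁ ^ (-(B.φ s 1)) * B.s₀ ^ (-(B.φ s 0))) = 0 := by
    have := B.φ_proj s; rwa [proj] at this
  refine ⟨(Walk.cons (adj_mul_of_mem S (Or.inl hs) hs1 1) (((w₂.append w₃).copy (one_mul s).symm rfl))).copy rfl (by rw [proj]),
    fun z hz => ?_⟩
  rw [support_copy, support_cons, List.mem_cons, support_copy, support_append, List.mem_append] at hz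
  rcases hz with rfl | hz | hz
  · exact Or.inl h1
  · rcases hw₂ z hz with rfl | rfl
    · exact Or.inr (Or.inl rfl)
    · exact Or.inr (Or.inr e₂)
  · rcases hw₃ z (List.tail_subset _ hz) with rfl | rfl
    · exact Or.inr (Or.inr e₂)
    · exact Or.inl e₃

/-- The heights of the projection walk lie in the unit box. [folklore] -/
theorem proj_heights_mem_box {s : Γ} (hs : s ∈ S) {v : Site 2} (hv : v = 0 ∨ v = B.φ s ∨ v = Pi.single 0 (B.φ s 0)) : v ∈ box 2 1 := by
  have hsb : ∀ i, -1 ≤ B.φ s i ∧ B.φ s i ≤ 1 := fun i => by have := B.lip s hs i; rw [abs_le] at this; exact this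
  rw [mem_box]
  rcases hv with rfl | rfl | rfl
  · intro i; simp
  · exact fun i => by exact_mod_cast hsb i
  · intro i; fin_cases i
    · simpa using hsb 0
    · simp

/-! ## §2 The companion alphabet -/

/-- The COMPANION ALPHABET: `{s₀^{±1}, s₁^{±1}} ∪ {π(s), π(s)⁻¹ : s ∈ S}` — a letters-type generating system of the same group. [folklore] -/
def compAlph : Set Γ :=
  ({B.s₀, B.s₀⁻¹, B.s₁, B.s₁⁻¹} : Set Γ) ∪ ((fun s => B.proj s) '' (S : Set Γ) ∪ (fun s => (B.proj s)⁻¹) '' (S : Set Γ))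

/-- The companion alphabet is symmetric. [folklore] -/
theorem compAlph_symm : ∀ a ∈ B.compAlph, a⁻¹ ∈ B.compAlph := by
  rintro a (ha | ⟨s, hs, rfl⟩ | ⟨s, hs, rfl⟩)
  · simp only [Set.mem_insert_iff, Set.mem_singleton_iff] at ha
    rcases ha with rfl | rfl | rfl | rfl
    · exact Or.inl (by simp)
    · exact Or.inl (by simp)
    · exact Or.inl (by simp)
    · exact Or.inl (by simp)
  · exact Or.inr (Or.inr ⟨s, hs, rfl⟩)
  · exact Or.inr (Or.inl ⟨s, hs, by rw [inv_inv]⟩)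

/-- The companion alphabet is letters-type: every letter is in `ker φ` or among `s₀^{±1}, s₁^{±1}`. [folklore] -/
theorem compAlph_letters : ∀ a ∈ B.compAlph, B.φ a = 0 ∨ a = B.s₀ ∨ a = B.s₀⁻¹ ∨ a = B.s₁ ∨ a = B.s₁⁻¹ := by
  rintro a (ha | ⟨s, -, rfl⟩ | ⟨s, -, rfl⟩)
  · simp only [Set.mem_insert_iff, Set.mem_singleton_iff] at ha
    rcases ha with rfl | rfl | rfl | rfl
    · exact Or.inr (Or.inl rfl)
    · exact Or.inr (Or.inr (Or.inl rfl))
    · exact Or.inr (Or.inr (Or.inr (Or.inl rfl)))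
    · exact Or.inr (Or.inr (Or.inr (Or.inr rfl)))
  · exact Or.inl (B.φ_proj s)
  · exact Or.inl (by rw [B.φ_inv, B.φ_proj, neg_zero])

/-- The companion alphabet generates (`s = π(s) · s₀^{φ₀ s} · s₁^{φ₁ s}`). [folklore] -/
theorem closure_compAlph (hS : Subgroup.closure (S : Set Γ) = ⊤) : Subgroup.closure B.compAlph = ⊤ := by
  rw [eq_top_iff, ← hS, Subgroup.closure_le]
  intro s hs
  have hx : B.s₀ ∈ Subgroup.closure B.compAlph := Subgroup.subset_closure (Or.inl (by simp))
  have hy : B.s₁ ∈ Subgroup.closure B.compAlph := Subgroup.subset_closure (Or.inl (by simp))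
  have hp : B.proj s ∈ Subgroup.closure B.compAlph := Subgroup.subset_closure (Or.inr (Or.inl ⟨s, hs, rfl⟩))
  have e : s = B.proj s * B.s₀ ^ (B.φ s 0) * B.s₁ ^ (B.φ s 1) := by rw [proj]; group
  rw [SetLike.mem_coe, e]
  exact Subgroup.mul_mem _ (Subgroup.mul_mem _ hp (Subgroup.zpow_mem _ hx _)) (Subgroup.zpow_mem _ hy _)

end CylBase

end CayCyl

end Summit.CriticalPhenomena.PercolationContinuityZ3.Theorems.Transplant

end
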